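import Summits.CriticalPhenomena.PercolationContinuityZ3.Theorems.PercNearOneGluingNoHeavyLowerTailSahiOneStepFibreF3Defs
import Mathlib.Combinatorics.Colex
import Mathlib.Order.Interval.Finset.Nat
import HarnessLib

/-!
# One-step scheme: the CHECKER for the three-copy fibre forms on pairs of upper families (review-queued definitions, D-0009)

Definitions file (prover prim-ineq-prove-3 gen 16; `--supports stmt-CriticalPhenomena-4575`; memo
`run/shared/lean/prim/prim-ineq-prove-3/FINDING-G16-FIBRE-MAJ5.md` §3.6, §3.8).  A program deciding, for a form `(d1, d2, θ)` of `…FibreF3Defs`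
(`D₁ = range d1`, `D₂ = Ico d1 (d1+d2)`), that `f3sum ℤ D₁ D₂ θ 1_U 1_V ≥ 0` for ALL pairs of upper families `U, V` of `P(range (d1+d2))`:
* `code S = Σ_{i∈S} 2^i`, `maskOf U = Σ_{S∈U} 2^{code S}`; `indMask R m` = the indicator `S ↦ [bit (code S) of m]`, `bitR R m c = [bit c of m]`;
* `upMasks n` — the masks of all upper families of `P(range n)` by the recursion `m₀ + 2^(2^n)·m₁` (`m₀ ⊆ m₁` upper families of `P(range n)`:
  the members avoiding `n` and the traces of the members containing `n`); `|upMasks 4| = 168`, `|upMasks 5| = 7581`; `upPairs n` the comparable index pairs;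
* `qdata d1 d2 θ` — per quadruple `q`: `(q, code S₁, code S₂, α_q, γ_q)` with `f3term(1_U, 1_V)(q) = [S₁∈U]·(α_q[S₁∈V] + γ_q[S₂∈V])`;
  `Aentry`, `Bdiag` the resulting coefficient tables; `maskSum` a masked partial sum of an array;
* `checkSlow d1 d2 θ` (double loop over `upMasks (d1+d2)`, for `d1 + d2 ≤ 4`) and `checkFive d1 θ` (`d1 + d2 = 5`, both families enumerated as pairs over
  `upMasks 4`, ≈ 10⁸ interpreter steps ≈ 45 s).  Soundness and completeness are PROVED in `…FibreF3CheckSound`; the checks themselves are run by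
  `native_decide` in `…FibreF3CheckLeFour` / `…FibreF3CheckFiveD*` (computational files).
-/

namespace Summit.CriticalPhenomena.PercolationContinuityZ3.Theorems

namespace SahiOneStep

open Finset

/-- The binary code of a finset of naturals: `Σ_{i ∈ S} 2^i`. -/
def code (S : Finset ℕ) : ℕ := ∑ i ∈ S, 2 ^ i

/-- The mask of a family of finsets: `Σ_{S ∈ U} 2^{code S}`. -/
def maskOf (U : Finset (Finset ℕ)) : ℕ := ∑ S ∈ U, 2 ^ code S

/-- `bitSubset k a b`: every bit `< k` set in `a` is set in `b`. -/
def bitSubset (k : ℕ) (a b : ℕ) : Bool := (List.range k).all fun c => !a.testBit c || b.testBit c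

/-- The masks of all upper families of `P(range n)`, by the recursion "sets avoiding `n` ∪ (sets containing `n`)":
`m₀ + 2^(2^n)·m₁` with `m₀ ⊆ m₁` upper families of `P(range n)`. -/
def upMasks : ℕ → List ℕ
  | 0 => [0, 1]
  | n + 1 => (upMasks n).flatMap fun m₁ => ((upMasks n).filter fun m₀ => bitSubset (2 ^ n) m₀ m₁).map fun m₀ => m₀ + 2 ^ (2 ^ n) * m₁

/-- The indicator of a mask as a function of patterns: `S ↦ [bit (code S) of m]`. -/
def indMask (R : Type*) [Zero R] [One R] (m : ℕ) (S : Finset ℕ) : R := if m.testBit (code S) = true then 1 else 0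

/-- Bit `c` of `m` as a ring element. -/
def bitR (R : Type*) [Zero R] [One R] (m c : ℕ) : R := if m.testBit c = true then 1 else 0

/-- The quadruple data of the form `(d1, d2, θ)`: `(q, code S₁, code S₂, α_q, γ_q)` with `α = h₁(1 − h₀)`, `γ = h₁h₂ + h₀ − h₁ − h₂`. -/
def qdata (d1 d2 θ : ℕ) : Finset ((((Finset ℕ × Finset ℕ) × (Finset ℕ × Finset ℕ))) × ℕ × ℕ × ℤ × ℤ) :=
  (f3quads (Finset.range d1) (Finset.Ico d1 (d1 + d2))).image fun q =>
    (q, code (f3S1 (Finset.Ico d1 (d1 + d2)) q), code (f3S2 (Finset.range d1) q),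
      thrR ℤ θ (f3S1 (Finset.Ico d1 (d1 + d2)) q) * (1 - thrR ℤ θ (f3S0 (Finset.Ico d1 (d1 + d2)) q)),
      thrR ℤ θ (f3S1 (Finset.Ico d1 (d1 + d2)) q) * thrR ℤ θ (f3S2 (Finset.range d1) q) + thrR ℤ θ (f3S0 (Finset.Ico d1 (d1 + d2)) q)
        - thrR ℤ θ (f3S1 (Finset.Ico d1 (d1 + d2)) q) - thrR ℤ θ (f3S2 (Finset.range d1) q))

/-- Off-diagonal coefficient: `Σ_{x : c₁(x) = c₁, c₂(x) = c₂} γ_x`. -/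
def Aentry (Q : Finset ((((Finset ℕ × Finset ℕ) × (Finset ℕ × Finset ℕ))) × ℕ × ℕ × ℤ × ℤ)) (c₁ c₂ : ℕ) : ℤ :=
  ∑ x ∈ Q, if x.2.1 = c₁ ∧ x.2.2.1 = c₂ then x.2.2.2.2 else 0

/-- Diagonal coefficient: `Σ_{x : c₁(x) = c₁} α_x`. -/
def Bdiag (Q : Finset ((((Finset ℕ × Finset ℕ) × (Finset ℕ × Finset ℕ))) × ℕ × ℕ × ℤ × ℤ)) (c₁ : ℕ) : ℤ :=
  ∑ x ∈ Q, if x.2.1 = c₁ then x.2.2.2.1 else 0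

/-- `Σ_{c < k, bit c of m} r[c + off]`. -/
def maskSum (k : ℕ) (m : ℕ) (r : Array ℤ) (off : ℕ) : ℤ :=
  (List.range k).foldl (fun acc c => if m.testBit c = true then acc + r.getD (c + off) 0 else acc) 0

/-- Index pairs `(i₀, i₁)` into `upMasks n` with mask `i₀` bitwise below mask `i₁`. -/
def upPairs (n : ℕ) : List (ℕ × ℕ) :=
  (List.range (upMasks n).length).flatMap fun i₁ =>
    ((List.range (upMasks n).length).filter fun i₀ => bitSubset (2 ^ n) ((upMasks n).getD i₀ 0) ((upMasks n).getD i₁ 0)).map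
      fun i₀ => (i₀, i₁)

/-- **Slow checker**: the form `(d1, d2, θ)` is nonnegative on all pairs of upper families of `P(range (d1+d2))` (double loop). -/
def checkSlow (d1 d2 θ : ℕ) : Bool :=
  let N := 2 ^ (d1 + d2)
  let Q := qdata d1 d2 θ
  let A : Array ℤ := Array.ofFn (n := N * N) fun k => Aentry Q (k.val / N) (k.val % N)
  let B : Array ℤ := Array.ofFn (n := N) fun k => Bdiag Q k.val
  (upMasks (d1 + d2)).all fun V =>
    let r : Array ℤ := Array.ofFn (n := N) fun c₁ => bitR ℤ V c₁.val * B.getD c₁.val 0 + maskSum N V A (c₁.val * N)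
    (upMasks (d1 + d2)).all fun U => decide (0 ≤ maskSum N U r 0)

/-- **Fast checker for five free coordinates**: both families enumerated as pairs over `upMasks 4`. -/
def checkFive (d1 θ : ℕ) : Bool :=
  let Q := qdata d1 (5 - d1) θ
  let A : Array ℤ := Array.ofFn (n := 32 * 32) fun k => Aentry Q (k.val / 32) (k.val % 32)
  let B : Array ℤ := Array.ofFn (n := 32) fun k => Bdiag Q k.val
  let L4 : List ℕ := upMasks 4
  (upPairs 4).all fun jj =>
    let V := L4.getD jj.1 0 + 2 ^ (2 ^ 4) * L4.getD jj.2 0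
    let r : Array ℤ := Array.ofFn (n := 32) fun c₁ => bitR ℤ V c₁.val * B.getD c₁.val 0 + maskSum 32 V A (c₁.val * 32)
    let v0 : Array ℤ := Array.ofFn (n := L4.length) fun i => maskSum 16 (L4.getD i.val 0) r 0
    let v1 : Array ℤ := Array.ofFn (n := L4.length) fun i => maskSum 16 (L4.getD i.val 0) r 16
    (upPairs 4).all fun ii => decide (0 ≤ v0.getD ii.1 0 + v1.getD ii.2 0)

end SahiOneStep

end Summit.CriticalPhenomena.PercolationContinuityZ3.Theorems
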